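import Summits.BirchSwinnertonDyer.BirchSwinnertonDyer.Theorems.BiquadraticEisensteinDescentHeegnerTwistCouplingInSupplyNonNullIffUpperDensity
import Literature.NumberTheory.QuadraticFields.FundamentalDiscriminant
import Literature.NumberTheory.QuadraticFields.ImaginaryQuadraticPrescribedSplitting
import HarnessLib

set_option linter.dupNamespace false -- `Summit.BirchSwinnertonDyer.BirchSwinnertonDyer.Theorems.…` (summit = sub, D-0017)
set_option autoImplicit false

/-!
# Crux `HeegnerTwistCouplingInSupply` (stmt-BirchSwinnertonDyer-21381): the registered stub C⁺ IMPLIES the Cohen–Lenstra-type lower bound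
# «`p ∤ h(D)` for a positive upper density of odd negative fundamental discriminants `D`», for every prime `p ≥ 5` — BARRIER CERTIFICATE

Route `BiquadraticEisensteinDescent` (cell `pub/bsd-wall`; width seat `bsd-wall-cm-bed-w1` g17; theorems only, `--supports 21381`).
At level `N = 1` the Heegner hypothesis is vacuous (`satisfiesHeegnerHypothesis_one`) and the odd Heegner family of `…InertBadAtThreeNonNullOddHeegner`
is the set of ALL odd negative fundamental discriminants `−X < D < 0` (`oddHeegnerFamily_one_eq`); C⁺ is antitone in the level (`…NonNullBasics.nonNull_of_dvd`),
and C⁺(N,p) ⟺ positive upper density of `p ∤ h` over the family (`…NonNullIffUpperDensity`). Hence: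

* ★ `upperDensity_indivisible_of_nonNull` — C⁺(N, p) for ANY level `N` ⟹ `∃ ε > 0, ∃ᶠ X, ε·X ≤ #{−X < D < 0 : D odd fundamental, p ∤ h(D)}`;
* ★★ `upperDensity_indivisible_of_stub` — the registered stub (by value) ⟹ that lower bound for EVERY prime `p ≥ 5`: a W-free, N-free, L-free statement
  about class numbers of imaginary quadratic fields which is OPEN in print (best unconditional: `≫ √X / log X` discriminants, Kohnen–Ono 1999 Thm 1;
  positive proportion known only at `p = 3`, Davenport–Heilbronn; predicted density `∏_{i≥1}(1 − p^{−i}) > 0`, Cohen–Lenstra 1984). So C⁺ is AT LEAST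
  as hard as that problem — the kernel form of residual R1 of the ideation memos (OBSTRUCTIONS-seat1-g22 §7) and of the lead's verdict «C⁺ ⊇ a problem open
  since Cohen–Lenstra (1984)» (LEAD-NOTE-ibd-p1-g6 §3);
* `nonNull_one_iff_upperDensity_indivisible` — at level `1` the two are EQUIVALENT.

HONEST FRAMING: implications between formulations; nothing here proves C⁺, the Cohen–Lenstra bound, the crux, or BSD. No definition, no named fact,
no `sorry`; axioms standard. [cite: KohnenOno1999, Thm. 1] [cite: Cox2013, §7.B Thm. 7.7(ii)] [cite: arXiv250317619, §1]
-/

noncomputable section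

open scoped Classical
open Finset Filter Topology
open Literature.NumberTheory.QuadraticFields Literature.NumberTheory.QuadraticFields.Quadratic Literature.NumberTheory.EllipticCurves
open Summit.BirchSwinnertonDyer.BirchSwinnertonDyer.Theorems.InertBadSignedBranchesInertBadAtThreeNonNullOddHeegner
open Summit.BirchSwinnertonDyer.BirchSwinnertonDyer.Theorems.BiquadraticEisensteinDescentHeegnerTwistCouplingInSupplyNonNullBasics
open Summit.BirchSwinnertonDyer.BirchSwinnertonDyer.Theorems.BiquadraticEisensteinDescentHeegnerTwistCouplingInSupplyNonNullIffUpperDensity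

namespace Summit.BirchSwinnertonDyer.BirchSwinnertonDyer.Theorems.BiquadraticEisensteinDescentHeegnerTwistCouplingInSupplyNonNullImpliesCohenLenstra

/-! ## §1 Level `1`: the Heegner hypothesis is vacuous, the family is all odd negative fundamental discriminants -/

/-- At level `N = 1` the Heegner hypothesis holds for every field (no prime divides `1`). [cite: GrossLMS1991, §1] -/
theorem satisfiesHeegnerHypothesis_one (K : Type) [Field K] : SatisfiesHeegnerHypothesis 1 K :=
  fun p hp hp1 ↦ absurd (Nat.le_of_dvd one_pos hp1) (by have := hp.two_le; omega)

/-- **Every negative fundamental discriminant is the discriminant of an imaginary quadratic field** (existence of the field: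
`FundamentalDiscriminant.exists_numberField_discr_eq`; total complexity from `d_K < 0`). [folklore] -/
theorem exists_isImaginaryQuadratic_discr_eq {X : ℕ} {D : ℤ} (hD : D ∈ negFundDiscrs X) :
    ∃ (K : Type) (_ : Field K) (_ : NumberField K), IsImaginaryQuadratic K ∧ NumberField.discr K = D := by
  rw [mem_negFundDiscrs] at hD
  obtain ⟨⟨-, hD0⟩, hfund⟩ := hD
  obtain ⟨K, iF, iN, h2, hdisc⟩ := exists_numberField_discr_eq hfund
  exact ⟨K, iF, iN, ⟨h2, isTotallyComplex_of_discr_neg h2 (hdisc ▸ hD0)⟩, hdisc⟩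

/-- **At level `1` the odd Heegner family is the set of all odd negative fundamental discriminants `−X < D < 0`.** [folklore] -/
theorem oddHeegnerFamily_one_eq (X : ℕ) :
    (negFundDiscrs X).filter (fun D => Odd D ∧ ∃ (K : Type) (_ : Field K) (_ : NumberField K),
        IsImaginaryQuadratic K ∧ NumberField.discr K = D ∧ SatisfiesHeegnerHypothesis 1 K) =
      (negFundDiscrs X).filter (fun D => Odd D) := by
  refine Finset.filter_congr fun D hD ↦ ⟨fun h ↦ h.1, fun h ↦ ⟨h, ?_⟩⟩
  obtain ⟨K, iF, iN, hK, hdK⟩ := exists_isImaginaryQuadratic_discr_eq hD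
  exact ⟨K, iF, iN, hK, hdK, satisfiesHeegnerHypothesis_one K⟩

/-- The indivisible part at level `1`: `{D ∈ Q_1(X) : p ∤ h(D)} = {−X < D < 0 odd fundamental : p ∤ h(D)}`. [folklore] -/
theorem indivisibleFamily_one_eq (p X : ℕ) :
    ((negFundDiscrs X).filter (fun D => Odd D ∧ ∃ (K : Type) (_ : Field K) (_ : NumberField K),
        IsImaginaryQuadratic K ∧ NumberField.discr K = D ∧ SatisfiesHeegnerHypothesis 1 K)).filter
        (fun D => ¬ p ∣ BinQF.classNumber D) =
      (negFundDiscrs X).filter (fun D => Odd D ∧ ¬ p ∣ BinQF.classNumber D) := by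
  rw [oddHeegnerFamily_one_eq, Finset.filter_filter]

/-! ## §2 C⁺ ⟹ the Cohen–Lenstra-type positive upper density -/

/-- ★ **C⁺(N, p) ⟹ positive upper density of `p ∤ h(D)` among odd negative fundamental discriminants** (`p` prime; any level `N`, via
C⁺(N,p) ⟹ C⁺(1,p)). [cite: KohnenOno1999, Thm. 1] [cite: Cox2013, §7.B Thm. 7.7(ii)] -/
theorem upperDensity_indivisible_of_nonNull {N p : ℕ} (hp : p.Prime)
    (hC : ¬ twistDensity (fun d : ℤ ↦ ∃ (K : Type) (_ : Field K) (_ : NumberField K),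
      IsImaginaryQuadratic K ∧ NumberField.discr K = d ∧ 4 < d.natAbs ∧
      SatisfiesHeegnerHypothesis N K ∧ ¬ p ∣ NumberField.classNumber K) 0) :
    ∃ ε : ℝ, 0 < ε ∧ ∃ᶠ X : ℕ in atTop,
      ε * (X : ℝ) ≤ (((negFundDiscrs X).filter (fun D => Odd D ∧ ¬ p ∣ BinQF.classNumber D)).card : ℝ) := by
  have h1 := nonNull_of_dvd (one_dvd N) p hC
  obtain ⟨ε, hε, hfreq⟩ := (nonNull_iff_frequently_mul_le_card_indivisible one_ne_zero hp).mp h1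
  exact ⟨ε, hε, hfreq.mono fun X hX ↦ by rwa [indivisibleFamily_one_eq] at hX⟩

/-- ★ **At level `1` the converse holds too**: C⁺(1, p) ⟺ positive upper density of `p ∤ h(D)` among odd negative fundamental discriminants
(`p` prime). [cite: KohnenOno1999, Thm. 1] [cite: Cox2013, §7.B Thm. 7.7(ii)] -/
theorem nonNull_one_iff_upperDensity_indivisible {p : ℕ} (hp : p.Prime) :
    (¬ twistDensity (fun d : ℤ ↦ ∃ (K : Type) (_ : Field K) (_ : NumberField K),
      IsImaginaryQuadratic K ∧ NumberField.discr K = d ∧ 4 < d.natAbs ∧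
      SatisfiesHeegnerHypothesis 1 K ∧ ¬ p ∣ NumberField.classNumber K) 0) ↔
    ∃ ε : ℝ, 0 < ε ∧ ∃ᶠ X : ℕ in atTop,
      ε * (X : ℝ) ≤ (((negFundDiscrs X).filter (fun D => Odd D ∧ ¬ p ∣ BinQF.classNumber D)).card : ℝ) := by
  rw [nonNull_iff_frequently_mul_le_card_indivisible one_ne_zero hp]
  simp_rw [indivisibleFamily_one_eq]

/-- ★★ **BARRIER CERTIFICATE.** The registered stub `stub_nonNullIndivisibleHeegner` of line `size_tail` (by value) implies, for EVERY prime `p ≥ 5`,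
a positive upper density of odd negative fundamental discriminants `D` with `p ∤ h(D)` — the Cohen–Lenstra-type lower bound that is open in print
(Kohnen–Ono: `≫ √X/log X` only). [cite: KohnenOno1999, Thm. 1] [cite: Cox2013, §7.B Thm. 7.7(ii)] -/
theorem upperDensity_indivisible_of_stub
    (hC : ∀ (N p : ℕ), N ≠ 0 → p.Prime → 5 ≤ p →
      ¬ twistDensity (fun d : ℤ ↦ ∃ (K : Type) (_ : Field K) (_ : NumberField K),
        IsImaginaryQuadratic K ∧ NumberField.discr K = d ∧ 4 < d.natAbs ∧
        SatisfiesHeegnerHypothesis N K ∧ ¬ p ∣ NumberField.classNumber K) 0)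
    {p : ℕ} (hp : p.Prime) (hp5 : 5 ≤ p) :
    ∃ ε : ℝ, 0 < ε ∧ ∃ᶠ X : ℕ in atTop,
      ε * (X : ℝ) ≤ (((negFundDiscrs X).filter (fun D => Odd D ∧ ¬ p ∣ BinQF.classNumber D)).card : ℝ) :=
  upperDensity_indivisible_of_nonNull hp (hC 1 p one_ne_zero hp hp5)

/-- **And conversely the stub FOLLOWS from the level-by-level density statements** (by `…NonNullIffUpperDensity`): C⁺ for all `N ≠ 0`, `p ≥ 5`
⟸ for every `N ≠ 0` and prime `p ≥ 5`, `p ∤ h(D)` has positive upper density over the odd Heegner family of level `N`. (The level-`1` statement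
alone does NOT give the higher levels: Heegner conditions cut the family down.) [cite: Cox2013, §7.B Thm. 7.7(ii)] -/
theorem stub_of_upperDensity_allLevels
    (h : ∀ (N p : ℕ), N ≠ 0 → p.Prime → 5 ≤ p → ∃ ε : ℝ, 0 < ε ∧ ∃ᶠ X : ℕ in atTop, ε * (X : ℝ) ≤
      ((((negFundDiscrs X).filter (fun D => Odd D ∧ ∃ (K : Type) (_ : Field K) (_ : NumberField K),
        IsImaginaryQuadratic K ∧ NumberField.discr K = D ∧ SatisfiesHeegnerHypothesis N K)).filter
        (fun D => ¬ p ∣ BinQF.classNumber D)).card : ℝ)) :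
    ∀ (N p : ℕ), N ≠ 0 → p.Prime → 5 ≤ p →
      ¬ twistDensity (fun d : ℤ ↦ ∃ (K : Type) (_ : Field K) (_ : NumberField K),
        IsImaginaryQuadratic K ∧ NumberField.discr K = d ∧ 4 < d.natAbs ∧
        SatisfiesHeegnerHypothesis N K ∧ ¬ p ∣ NumberField.classNumber K) 0 :=
  fun N p hN hp hp5 ↦ (nonNull_iff_frequently_mul_le_card_indivisible hN hp).mpr (h N p hN hp hp5)

end Summit.BirchSwinnertonDyer.BirchSwinnertonDyer.Theorems.BiquadraticEisensteinDescentHeegnerTwistCouplingInSupplyNonNullImpliesCohenLenstra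

end
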